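import Summits.QuantumFields.BalabanUV.T4Continuum.Support.NE7MinNormGaugeRepresentative
import Summits.QuantumFields.BalabanUV.T4Continuum.Support.NE7QbarKernelDecomposition
import Summits.QuantumFields.BalabanUV.T4Continuum.Support.NE7ConstrainedPoincareAssembly
import Summits.QuantumFields.BalabanUV.T4Continuum.Support.NE3SlicePoincareShape

/-!
# NE7SlicePoincareTA — THE LETTER (H1) OF THE END F218 FROM ROW NE3's SLICE POINCARÉ SHAPE ON ITS OWN SLICE, BY ORBIT COMPARISON: if
# `SlicePoincare L (j+1) W (frameFreeBlockLandauW L N (j+1) W) C (periodBox (N·L^{j+1}))` (row NE3's (P♮)_W, proved class-uniformly by `NE3ClassSlicePoincare.classSlicePoincare_of_lines`),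
# then on print's slice `T_A = ker Q̄_W ∩ {R D_W† = 0}`: `dirSq(extF t) ≤ 4·n·(1 + 4C_div²)·C·M²·curlSq_W(extF t)` under ONE class-line smallness `64·n²·#Plane·η²·M⁴·(1 + 2C_div²)·C ≤ 1`
# (file 152 of the curved (APE), F223)

Cell `pub-balaban`, rung (B)+1 sub-cell t4, lineage `b2b-balaban-t4-ne7-p1` (CRUX PROVER NE7 #1 = OWNER of row NE7), generation 86; memo
`t4/b2b-balaban-t4-ne7-p1-g86/ORBIT-COMPARISON.md` §4.  Assembly BY NAME of F219 `NE7QbarKernelDecomposition.exists_avgKernelGauge_mem_frameFreeBlockLandauW` (`ker Q̄_W = T_♮ + D_W N`),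
F222 `NE7MinNormGaugeRepresentative` (min-norm section `t_L`; `‖t‖² ≤ (1+4C_div²)‖t_L‖²` for `t ∈ T_A`; `‖t_L‖ ≤ ‖s‖`), F215 `NE7ConstrainedPoincareAssembly.curlSq_pureGauge_le` (gauge-curl
smallness `ε_g = 16n·#Plane·η²M²`), F193 `qbarOpK_eq_zero_iff`, row NE3's `NE3SlicePoincareShape.SlicePoincare` and the currency bridges `NE3BlockPoincareTangent.dirSq_le_card_mul_sum_nhs` ∕
`NE7LandauDivBound.norm_sq_le_dirSq`.
THE CHAIN (`D` = `dirSq`, `K` = `curlSq_W`, norms on the skew torus 1-forms; `s = t + D_Wλ₁ ∈ T_♮`, `t_L = t − D_Wλ₂ ⊥ D_W N`):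
`D(t) ≤ n‖t‖² ≤ n(1+4C_div²)‖t_L‖² ≤ n(1+4C_div²)‖s‖² ≤ n(1+4C_div²)D(s) ≤ n(1+4C_div²)·C·M²·K(s)`, `K(s) ≤ 2K(t) + 2K(D_Wλ₁) ≤ 2K(t) + 2ε_g·D(D_Wλ₁)`,
`D(D_Wλ₁) ≤ n‖s − t‖² ≤ n(2 + 2(1+4C_div²))‖s‖² ≤ …·C·M²·K(s)` — bootstrap under the displayed line, `K(s) ≤ 4K(t)`.
WHAT ([folklore]; 0 def, 0 sorry).  §1 `curlSq_le_of_eq_add`, `extF_add_pureGauge`, `core_boot` (pure-ℝ); §2 **`slicePoincare_TA_of_frameFree`** (the title), in the literal shape of (H1) of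
F217∕F218 (`∀ t, qbarOpK t = 0 → landauProjK (D_W† t) = 0 → dirSq(extF t) ≤ C_T·curlSq_W(extF t)`).
HONEST FRAMING (page 1): (H1) is hereby REDUCED to row NE3's (P♮)_W on `frameFreeBlockLandauW` (a THEOREM of row NE3 in the small-field class under its four k-free numeric lines,
`NE3ClassSlicePoincare.classSlicePoincare_of_lines`, `3 ≤ d`); (P_a) and the END's first letter follow in the class (next file); the rows (C) of `cGreenSymKa` ([B9] Thm 3.3∕(3.49) shape)
remain; (KL-B), (APE) on curved data NOT proved unconditionally; NOT ONE-STEP, NOT NE7; spine 0∕9; finite T⁴ rung (B)+1 — NOT infinite volume, NOT mass gap, NOT `BetaPertH`, NOT Clay.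
Continuum YM on T⁴ ⇐ BetaPertH ∧ nine spine estimates (0/9 proved); BetaPertH ⇐ (D1) ∧ (D4) ∧ CAP+tail; G-an2-4 gates asym, D1 and NE2/3/4.
-/

set_option autoImplicit false

open scoped BigOperators InnerProductSpace Matrix Matrix.Norms.L2Operator
open Finset

namespace Summit.QuantumFields.BalabanUV.T4Continuum.NE7SlicePoincareTA

open Literature.MathematicalPhysics.QuantumFieldTheory.Balaban1983to89
open B7Prop1Explicit B7Prop2Explicit UnitaryModel MatrixNorms
open T4AveragingDeficitWall (IsUnitaryCfg IsSkewDir SmallField dirSq curlSq curl curlAt)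
open T4AveragingDeficitWallBoundary (periodBox IsPeriodicCfg)
open AveragingDeficitPeriodicCounting (IsPeriodicDir)
open AveragingDeficitMultiLevelPrep (tower LevelSmall)
open AveragingDeficitTwoLevelPrep (prop1Radius)
open SpreadLift (loopRad)
open BlockAveragePushDirGauge (gaugeDir isPeriodicDir_gaugeDir)
open NE3HilbertSchmidtTorus
open NE3.PairLandauB8 (avgKernelGauges mem_avgKernelGauges_iff)
open NE3EnergyHessContTwoTerm (curlSq_nonneg dirSq_nonneg)
open NE3EnergyHessBilin (curlAt_add)
open NE3TangentCovariantTower (QbarIter)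
open NE3FrameFreeSliceW (frameFreeBlockLandauW)
open NE3SlicePoincareShape (SlicePoincare)
open NE3FramePotBoundW (tower_eq_pow_mul)
open NE3BlockPoincareTangent (dirSq_le_card_mul_sum_nhs)
open NE7BalabanSoftOperator
open NE7GaugeFixOnPureGauges (resS_mem_of_avgKernel coe_gradOpK_resS)
open NE7ConstrainedGreenOnCarrier (qbarOpK_eq_zero_iff)
open NE7LandauCorrection (add_mem_avgKernelGauges)
open NE7LandauDivBound (norm_sq_le_dirSq)
open NE7ConstrainedPoincareAssembly (curlSq_pureGauge_le)
open NE7QbarKernelDecomposition (exists_avgKernelGauge_mem_frameFreeBlockLandauW)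
open NE7MinNormGaugeRepresentative (exists_minNorm_gauge norm_sq_le_of_landau_minNorm norm_sq_minNorm_le gradOpK_resS_add)
open NE7SquaredBumpNestedMeanOperator (tentMean2)

noncomputable section

variable {d : ℕ} {n : Type*} [Fintype n] [DecidableEq n]

/-! ## §1 Bookkeeping -/

/-- **PARALLELOGRAM BOUND FOR `curlSq`, TWO TERMS**: `s = a + b ⟹ curlSq W (extF s) ≤ 2·curlSq W (extF a) + 2·curlSq W (extF b)`. [folklore] -/
theorem curlSq_le_of_eq_add (W : Site d → Fin d → (Matrix n n ℂ)ˣ) {P : ℕ} [NeZero P] (a b s : skewForms d n P) (hs : s = a + b) (F : Finset (Site d)) :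
    curlSq W (extF P (s : Form d n P)) F ≤ 2 * curlSq W (extF P (a : Form d n P)) F + 2 * curlSq W (extF P (b : Form d n P)) F := by
  subst hs
  have hext : extF P ((a + b : skewForms d n P) : Form d n P) = extF P (a : Form d n P) + extF P (b : Form d n P) := by
    funext y κ; rw [Submodule.coe_add, extF_add]; rfl
  unfold curlSq
  rw [Finset.mul_sum, Finset.mul_sum, ← Finset.sum_add_distrib]
  refine Finset.sum_le_sum fun z _ => ?_
  rw [Finset.mul_sum, Finset.mul_sum, ← Finset.sum_add_distrib]
  refine Finset.sum_le_sum fun π _ => ?_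
  show ‖curlAt W (extF P ((a + b : skewForms d n P) : Form d n P)) z π.1.1 π.1.2‖ ^ 2
    ≤ 2 * ‖curlAt W (extF P (a : Form d n P)) z π.1.1 π.1.2‖ ^ 2 + 2 * ‖curlAt W (extF P (b : Form d n P)) z π.1.1 π.1.2‖ ^ 2
  rw [hext, curlAt_add]
  nlinarith [norm_add_le (curlAt W (extF P (a : Form d n P)) z π.1.1 π.1.2) (curlAt W (extF P (b : Form d n P)) z π.1.1 π.1.2),
    norm_nonneg (curlAt W (extF P (a : Form d n P)) z π.1.1 π.1.2 + curlAt W (extF P (b : Form d n P)) z π.1.1 π.1.2),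
    sq_nonneg (‖curlAt W (extF P (a : Form d n P)) z π.1.1 π.1.2‖ - ‖curlAt W (extF P (b : Form d n P)) z π.1.1 π.1.2‖)]

/-- `‖u − v‖² ≤ 2‖u‖² + 2‖v‖²`. [folklore] -/
theorem norm_sub_sq_le_two {E : Type*} [SeminormedAddCommGroup E] (u v : E) : ‖u - v‖ ^ 2 ≤ 2 * ‖u‖ ^ 2 + 2 * ‖v‖ ^ 2 := by
  nlinarith [norm_sub_le u v, norm_nonneg (u - v), sq_nonneg (‖u‖ - ‖v‖)]

omit [Fintype n] [DecidableEq n] in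
/-- **THE BOOTSTRAP CORE** (pure `ℝ`). [folklore] -/
theorem core_boot {Dt Nt NL Ns Ds Ks Kt Kg Dg Ng cn A C M2 eg : ℝ}
    (hcn : 0 ≤ cn) (hA : 0 ≤ A) (hC : 0 ≤ C) (hM2 : 0 ≤ M2) (heg : 0 ≤ eg) (hKs : 0 ≤ Ks)
    (h1 : Dt ≤ cn * Nt) (h2 : Nt ≤ A * NL) (h3 : NL ≤ Ns) (h4 : Ns ≤ Ds) (h5 : Ds ≤ C * M2 * Ks)
    (h6 : Ks ≤ 2 * Kt + 2 * Kg) (h7 : Kg ≤ eg * Dg) (h8 : Dg ≤ cn * Ng) (h9 : Ng ≤ 2 * Ns + 2 * Nt)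
    (hreg : 2 * eg * cn * (2 + 2 * A) * C * M2 ≤ 1 / 2) :
    Dt ≤ 4 * cn * A * C * M2 * Kt := by
  have hNs : Nt ≤ A * Ns := h2.trans (mul_le_mul_of_nonneg_left h3 hA)
  have hNg : Ng ≤ (2 + 2 * A) * (C * M2 * Ks) := by
    have : Ng ≤ (2 + 2 * A) * Ns := by nlinarith
    exact this.trans (mul_le_mul_of_nonneg_left (h4.trans h5) (by positivity))
  have hKg : Kg ≤ eg * (cn * ((2 + 2 * A) * (C * M2 * Ks))) :=
    h7.trans (mul_le_mul_of_nonneg_left (h8.trans (mul_le_mul_of_nonneg_left hNg hcn)) heg)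
  have hKs4 : Ks ≤ 4 * Kt := by
    have e : eg * (cn * ((2 + 2 * A) * (C * M2 * Ks))) = (2 * eg * cn * (2 + 2 * A) * C * M2) * Ks / 2 := by ring
    rw [e] at hKg
    have : (2 * eg * cn * (2 + 2 * A) * C * M2) * Ks ≤ (1 / 2) * Ks := mul_le_mul_of_nonneg_right hreg hKs
    linarith
  calc Dt ≤ cn * Nt := h1
    _ ≤ cn * (A * (C * M2 * Ks)) := mul_le_mul_of_nonneg_left (hNs.trans (mul_le_mul_of_nonneg_left (h4.trans h5) hA)) hcn
    _ ≤ cn * (A * (C * M2 * (4 * Kt))) := by gcongr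
    _ = 4 * cn * A * C * M2 * Kt := by ring

/-! ## §2 (H1) from row NE3's (P♮)_W on `frameFreeBlockLandauW` -/

section Carrier

variable [Nonempty n] {L N : ℕ} [NeZero N] (hL : 1 ≤ L) (hL2 : 2 ≤ L) (hLd : 2 ≤ L ^ d) (j : ℕ) [NeZero (N * L ^ (j + 1))]
  {W : Site d → Fin d → (Matrix n n ℂ)ˣ} {x : ℝ} (hWu : IsUnitaryCfg W) (hWP : IsPeriodicCfg W ((N * L ^ (j + 1) : ℕ) : ℤ))
  (hx : 0 ≤ x) (hs : LevelSmall d L j x) (hWx : SmallField W x)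

include hL2 hLd hWP in
/-- **(H1) ON PRINT's SLICE `T_A` FROM ROW NE3's SLICE POINCARÉ ON `T_♮`.**  Data: `L ≥ 2`, `L^d ≥ 2`, unitary `(N·L^{j+1})`-periodic `W` in the multi-level small-field class
(`LevelSmall d L j x`, `SmallField W x`), a plaquette radius `η` (`SmallField W η`), row NE3's gauge Poincaré regime `hsmall`, row NE3's (P♮)_W on `frameFreeBlockLandauW L N (j+1) W` with
constant `C ≥ 0`, and the class line `2·ε_g·n·(2 + 2(1+4C_div²))·C·M² ≤ 1∕2` (`ε_g = 16n·#Plane·η²M²`, `C_div² = n·d·(2 + 2(d−1)(M−1)Mx)²(2∕tentMean2)²`).  THEN every skew torus 1-form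
`t` with `Q̄_W t = 0` and `R D_W† t = 0` obeys `dirSq(extF t) ≤ 4·n·(1+4C_div²)·C·M²·curlSq_W(extF t)` on `periodBox (N·L^{j+1})`. [folklore] -/
theorem slicePoincare_TA_of_frameFree {η : ℝ} (hWη : SmallField W η)
    (hsmall : 8 * d * (((L : ℝ) ^ (j + 1)) * (((d : ℝ) - 1) * (((L : ℝ) ^ (j + 1)) - 1) * x)) ^ 2
      + 2 * (Fintype.card n * (4 * (d : ℝ) ^ 2 * ((L : ℝ) ^ (j + 1) - 1) ^ 2 * x + 16 * d * loopRad d L ((prop1Radius d L)^[j] x)) ^ 2) ≤ 1 / 2)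
    {C : ℝ} (hC : 0 ≤ C)
    (hP : SlicePoincare L (j + 1) W (frameFreeBlockLandauW (d := d) (n := n) L N (j + 1) W) C (periodBox (d := d) (N * L ^ (j + 1))))
    (hreg : 2 * (16 * Fintype.card n * (Fintype.card (T4AveragingDeficitWall.Plane d)) * η ^ 2 * ((L : ℝ) ^ (j + 1)) ^ 2) * (Fintype.card n : ℝ)
        * (2 + 2 * (1 + 4 * ((Fintype.card n : ℝ) * d * (2 + 2 * (((d : ℝ) - 1) * (((L : ℝ) ^ (j + 1)) - 1) * x) * (L : ℝ) ^ (j + 1)) ^ 2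
            * (2 / tentMean2 d (L ^ (j + 1))) ^ 2)))
        * C * ((L : ℝ) ^ (j + 1)) ^ 2 ≤ 1 / 2) :
    ∀ t : skewForms d n (N * L ^ (j + 1)), qbarOpK (N := N) hL j hWu hx hs hWx t = 0 →
      landauProjK L N (j + 1) W
          ((LinearMap.adjoint (𝕜 := ℝ) (E := skewSecs d n (N * L ^ (j + 1))) (F := skewForms d n (N * L ^ (j + 1))) (gradOpK hWu (N * L ^ (j + 1)))
            : skewForms d n (N * L ^ (j + 1)) →ₗ[ℝ] skewSecs d n (N * L ^ (j + 1))) t) = 0 →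
      dirSq (extF (N * L ^ (j + 1)) (t : Form d n (N * L ^ (j + 1)))) (periodBox (d := d) (N * L ^ (j + 1)))
        ≤ (4 * (Fintype.card n : ℝ)
            * (1 + 4 * ((Fintype.card n : ℝ) * d * (2 + 2 * (((d : ℝ) - 1) * (((L : ℝ) ^ (j + 1)) - 1) * x) * (L : ℝ) ^ (j + 1)) ^ 2
                * (2 / tentMean2 d (L ^ (j + 1))) ^ 2))
            * C * ((L : ℝ) ^ (j + 1)) ^ 2)
          * curlSq W (extF (N * L ^ (j + 1)) (t : Form d n (N * L ^ (j + 1)))) (periodBox (d := d) (N * L ^ (j + 1))) := by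
  intro t htQ htR
  have hL1 : 1 ≤ L := by omega
  have hP1 : 1 ≤ N * L ^ (j + 1) := Nat.one_le_iff_ne_zero.mpr (NeZero.ne _)
  have hM0 : (0 : ℝ) < (L : ℝ) ^ (j + 1) := by positivity
  have htow : ((tower L N (j + 1) : ℕ) : ℤ) = ((N * L ^ (j + 1) : ℕ) : ℤ) := by rw [tower_eq_pow_mul, Nat.mul_comm]
  have hWP' : IsPeriodicCfg W ((tower L N (j + 1) : ℕ) : ℤ) := by rw [htow]; exact hWP
  -- Step 0: `t` as a field; Bałaban's slice
  have hts : IsSkewDir (extF (N * L ^ (j + 1)) (t : Form d n (N * L ^ (j + 1)))) := t.2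
  have htP : IsPeriodicDir (extF (N * L ^ (j + 1)) (t : Form d n (N * L ^ (j + 1)))) ((tower L N (j + 1) : ℕ) : ℤ) := by
    rw [htow]; exact isPeriodicDir_extF _ _
  have htQ' : QbarIter L (j + 1) W (extF (N * L ^ (j + 1)) (t : Form d n (N * L ^ (j + 1)))) = 0 :=
    (qbarOpK_eq_zero_iff (N := N) hL j hWu hWP hx hs hWx t).mp htQ
  -- Step 1 (F219): `s := t + D_Wλ₁ ∈ T_♮`
  obtain ⟨lam₁, hlam₁, hX⟩ := exists_avgKernelGauge_mem_frameFreeBlockLandauW (N := N) hL1 hLd j hWu hWP' hx hs hWx hts htP htQ'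
  obtain ⟨-, hlam₁P, -⟩ := mem_avgKernelGauges_iff.mp hlam₁
  set g₁ : skewForms d n (N * L ^ (j + 1)) := gradOpK hWu (N * L ^ (j + 1)) ⟨resS (N * L ^ (j + 1)) lam₁, resS_mem_of_avgKernel hlam₁⟩ with hg₁
  set s : skewForms d n (N * L ^ (j + 1)) := t + g₁ with hsdef
  have hexts : extF (N * L ^ (j + 1)) (s : Form d n (N * L ^ (j + 1)))
      = fun y κ => extF (N * L ^ (j + 1)) (t : Form d n (N * L ^ (j + 1))) y κ + gaugeDir W lam₁ y κ := by
    funext y κ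
    rw [hsdef, Submodule.coe_add, extF_add, hg₁, coe_gradOpK_resS hWu hlam₁, extF_resF _ (isPeriodicDir_gaugeDir hWP hlam₁P)]
  have hPs := hP _ (hexts ▸ hX)
  -- Step 2 (F222): the min-norm representative `t_L := t − D_Wλ₂`
  obtain ⟨lam₂, hlam₂, horth⟩ := exists_minNorm_gauge (N := N) j hWu t
  set tL : skewForms d n (N * L ^ (j + 1)) := t - gradOpK hWu (N * L ^ (j + 1)) ⟨resS (N * L ^ (j + 1)) lam₂, resS_mem_of_avgKernel hlam₂⟩ with htL
  have h2 := norm_sq_le_of_landau_minNorm (N := N) hL2 j hWu hWP hx hs hWx hsmall t tL hlam₂ htL horth htR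
  -- Step 3 (F222): `‖t_L‖ ≤ ‖s‖`, since `s = t_L + D_W(λ₂ + λ₁)`
  have hs_eq : s = tL + gradOpK hWu (N * L ^ (j + 1)) ⟨resS (N * L ^ (j + 1)) (lam₂ + lam₁), resS_mem_of_avgKernel (add_mem_avgKernelGauges hlam₂ hlam₁)⟩ := by
    rw [gradOpK_resS_add j hWu hlam₂ hlam₁, hsdef, htL, hg₁]; abel
  have h3 : ‖tL‖ ^ 2 ≤ ‖s‖ ^ 2 := by
    have h := norm_sq_minNorm_le (N := N) j hWu tL horth (add_mem_avgKernelGauges hlam₂ hlam₁)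
    rwa [← hs_eq] at h
  -- currency bridges
  have h1 : dirSq (extF (N * L ^ (j + 1)) (t : Form d n (N * L ^ (j + 1)))) (periodBox (d := d) (N * L ^ (j + 1))) ≤ (Fintype.card n : ℝ) * ‖t‖ ^ 2 := by
    rw [Submodule.coe_norm, norm_sq_eq_sum_extF]; exact dirSq_le_card_mul_sum_nhs _ _
  have h4 : ‖s‖ ^ 2 ≤ dirSq (extF (N * L ^ (j + 1)) (s : Form d n (N * L ^ (j + 1)))) (periodBox (d := d) (N * L ^ (j + 1))) := norm_sq_le_dirSq s
  have h5 : dirSq (extF (N * L ^ (j + 1)) (s : Form d n (N * L ^ (j + 1)))) (periodBox (d := d) (N * L ^ (j + 1)))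
      ≤ C * ((L : ℝ) ^ (j + 1)) ^ 2 * curlSq W (extF (N * L ^ (j + 1)) (s : Form d n (N * L ^ (j + 1)))) (periodBox (d := d) (N * L ^ (j + 1))) := by
    have hM2 : (0 : ℝ) < ((L : ℝ) ^ (j + 1)) ^ 2 := by positivity
    have e : dirSq (extF (N * L ^ (j + 1)) (s : Form d n (N * L ^ (j + 1)))) (periodBox (d := d) (N * L ^ (j + 1)))
        = ((L : ℝ) ^ (j + 1)) ^ 2 * ((((L : ℝ) ^ (j + 1))⁻¹) ^ 2 * dirSq (extF (N * L ^ (j + 1)) (s : Form d n (N * L ^ (j + 1)))) (periodBox (d := d) (N * L ^ (j + 1)))) := by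
      field_simp
    rw [e]
    calc ((L : ℝ) ^ (j + 1)) ^ 2 * ((((L : ℝ) ^ (j + 1))⁻¹) ^ 2 * dirSq (extF (N * L ^ (j + 1)) (s : Form d n (N * L ^ (j + 1)))) (periodBox (d := d) (N * L ^ (j + 1))))
        ≤ ((L : ℝ) ^ (j + 1)) ^ 2 * (C * curlSq W (extF (N * L ^ (j + 1)) (s : Form d n (N * L ^ (j + 1)))) (periodBox (d := d) (N * L ^ (j + 1)))) :=
          mul_le_mul_of_nonneg_left hPs hM2.le
      _ = _ := by ring
  -- Step 4: curl splitting and gauge-curl smallness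
  have h6 := curlSq_le_of_eq_add W t g₁ s hsdef (periodBox (d := d) (N * L ^ (j + 1)))
  have h7 := curlSq_pureGauge_le (N := N) hL2 j hWu hWP hx hs hWx hWη hsmall hlam₁
  rw [← hg₁] at h7
  have h8 : dirSq (extF (N * L ^ (j + 1)) (g₁ : Form d n (N * L ^ (j + 1)))) (periodBox (d := d) (N * L ^ (j + 1))) ≤ (Fintype.card n : ℝ) * ‖g₁‖ ^ 2 := by
    rw [Submodule.coe_norm, norm_sq_eq_sum_extF]; exact dirSq_le_card_mul_sum_nhs _ _
  have h9 : ‖g₁‖ ^ 2 ≤ 2 * ‖s‖ ^ 2 + 2 * ‖t‖ ^ 2 := by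
    have e : g₁ = s - t := by rw [hsdef, add_sub_cancel_left]
    rw [e]; exact norm_sub_sq_le_two s t
  -- the bootstrap
  exact core_boot
    (Dt := dirSq (extF (N * L ^ (j + 1)) (t : Form d n (N * L ^ (j + 1)))) (periodBox (d := d) (N * L ^ (j + 1))))
    (Nt := ‖t‖ ^ 2) (NL := ‖tL‖ ^ 2) (Ns := ‖s‖ ^ 2)
    (Ds := dirSq (extF (N * L ^ (j + 1)) (s : Form d n (N * L ^ (j + 1)))) (periodBox (d := d) (N * L ^ (j + 1))))
    (Ks := curlSq W (extF (N * L ^ (j + 1)) (s : Form d n (N * L ^ (j + 1)))) (periodBox (d := d) (N * L ^ (j + 1))))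
    (Kt := curlSq W (extF (N * L ^ (j + 1)) (t : Form d n (N * L ^ (j + 1)))) (periodBox (d := d) (N * L ^ (j + 1))))
    (Kg := curlSq W (extF (N * L ^ (j + 1)) (g₁ : Form d n (N * L ^ (j + 1)))) (periodBox (d := d) (N * L ^ (j + 1))))
    (Dg := dirSq (extF (N * L ^ (j + 1)) (g₁ : Form d n (N * L ^ (j + 1)))) (periodBox (d := d) (N * L ^ (j + 1))))
    (Ng := ‖g₁‖ ^ 2) (cn := (Fintype.card n : ℝ))
    (A := 1 + 4 * ((Fintype.card n : ℝ) * d * (2 + 2 * (((d : ℝ) - 1) * (((L : ℝ) ^ (j + 1)) - 1) * x) * (L : ℝ) ^ (j + 1)) ^ 2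
                * (2 / tentMean2 d (L ^ (j + 1))) ^ 2))
    (C := C) (M2 := ((L : ℝ) ^ (j + 1)) ^ 2)
    (eg := 16 * Fintype.card n * (Fintype.card (T4AveragingDeficitWall.Plane d)) * η ^ 2 * ((L : ℝ) ^ (j + 1)) ^ 2)
    (Nat.cast_nonneg _) (by positivity) hC (by positivity) (by positivity) (curlSq_nonneg _ _ _)
    h1 h2 h3 h4 h5 h6 h7 h8 h9 hreg

end Carrier

end

end Summit.QuantumFields.BalabanUV.T4Continuum.NE7SlicePoincareTA
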